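import Mathlib
import HarnessLib

/-!
# Deshouillers–Iwaniec 1982, §7.1: the dyadic-block Cauchy–Schwarz bookkeeping behind Theorem 8

Topic `Literature/NumberTheory/Sieve` (sums of Kloosterman sums; used by the Deshouillers–Iwaniec /
Bombieri–Friedlander–Iwaniec cone).  Everything here is PROVED; no named fact, no hypothesis.

In the proof of Theorem 8 of J.-M. Deshouillers, H. Iwaniec, *Kloosterman sums and Fourier
coefficients of cusp forms*, Invent. Math. 70 (1982), §7.1 pp. 267–268 (and again in §9.1 p. 279),
the spectral side of Kuznietsov's formula is bounded by Cauchy–Schwarz in dyadic blocks of the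
spectrum: the Bessel–Kuznietsov transform supplies a weight `|f̂(t)| ≤ W` which decays like
`(T₀/|t|)³` beyond `T₀`, and the large sieve inequalities (Theorem 2) bound the two bilinear forms
cumulatively, `∑_{t_j ≤ K} |A_j|² ≤ α (K² + a)`, `∑_{t_j ≤ K} |B_j|² ≤ β (K² + b)`.  Summing over
the blocks gives `≪ W √(αβ) (T₀ + √a)(T₀ + √b)` up to a logarithm (the quantities `D₁ + D₁₂ + D₂` of
the source).  This file isolates that bookkeeping, once for sums (Maass cusp forms, holomorphic
forms) and once for integrals (Eisenstein series):

* `sum_blocks_le` — the numerical heart: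
  `∑_{k<K₁} min(1, (T₀/2^k)³)(2^{k+1}+x)(2^{k+1}+y) ≤ (14 + log₂⌊T₀⌋)(T₀+x)(T₀+y)`;
* `blocks_discrete` — `∑_j w_j x_j y_j ≤ (57 + 4 log₂⌊T₀⌋) W √(αβ)(T₀+√a)(T₀+√b)` for a finite set
  of indices with heights `h_j ≥ 0`, weights `w_j ≤ W`, `w_j ≤ W (T₀/h_j)³` (`h_j ≥ 1`) and the two
  cumulative bounds;
* `blocks_continuous` — the same for `∫_ℝ ω X Y` (Lebesgue integral of nonnegative functions, so
  that no integrability hypothesis is needed), via Hölder on the dyadic shells `shell k`;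
* `sum_tsum_le_of_sum_sum_le`, `summable_of_sum_sum_le` — passing from bounds on all finite partial
  sums of finitely many nonnegative series, taken jointly, to the sum of the series (used for the
  exceptional spectrum, where Theorem 7 bounds all levels at once).

## References
* J.-M. Deshouillers, H. Iwaniec, Invent. Math. 70 (1982) 219–288, §7.1 Lemma 7.1 and the proof of
  Theorem 8, pp. 264–268; §9.1 p. 279. [DeshouillersIwaniec1982]
-/

noncomputable section

open Real Finset MeasureTheory
open scoped ENNReal

namespace Literature.NumberTheory.Sieve

namespace DI

/-! ### The numerical heart: summing the transform majorant against dyadic large-sieve bounds -/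

/-- `2^{k₀} ≤ T₀ < 2^{k₀+1}` for `k₀ = log₂ ⌊T₀⌋`, `T₀ ≥ 1`. [folklore] -/
theorem two_pow_log_le {T₀ : ℝ} (hT : 1 ≤ T₀) :
    (2 : ℝ) ^ Nat.log 2 ⌊T₀⌋₊ ≤ T₀ ∧ T₀ < (2 : ℝ) ^ (Nat.log 2 ⌊T₀⌋₊ + 1) := by
  have h1 : 1 ≤ ⌊T₀⌋₊ := Nat.le_floor (by exact_mod_cast hT)
  constructor
  · have := Nat.pow_log_le_self 2 (Nat.pos_iff_ne_zero.1 h1)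
    calc (2 : ℝ) ^ Nat.log 2 ⌊T₀⌋₊ = ((2 ^ Nat.log 2 ⌊T₀⌋₊ : ℕ) : ℝ) := by push_cast; ring
      _ ≤ (⌊T₀⌋₊ : ℝ) := by exact_mod_cast this
      _ ≤ T₀ := Nat.floor_le (by linarith)
  · have := Nat.lt_pow_succ_log_self (b := 2) (by norm_num) ⌊T₀⌋₊
    calc T₀ < (⌊T₀⌋₊ : ℝ) + 1 := Nat.lt_floor_add_one T₀
      _ ≤ ((2 ^ (Nat.log 2 ⌊T₀⌋₊ + 1) : ℕ) : ℝ) := by exact_mod_cast this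
      _ = (2 : ℝ) ^ (Nat.log 2 ⌊T₀⌋₊ + 1) := by push_cast; ring

/-- The low blocks: `∑_{k ≤ k₀} (2^{k+1}+x)(2^{k+1}+y) ≤ (16/3)T₀² + 4T₀(x+y) + (k₀+1)xy`. [folklore] -/
theorem sum_low_blocks_le {T₀ x y : ℝ} (hT : 1 ≤ T₀) (hx : 0 ≤ x) (hy : 0 ≤ y) :
    ∑ k ∈ range (Nat.log 2 ⌊T₀⌋₊ + 1), ((2 : ℝ) ^ (k + 1) + x) * ((2 : ℝ) ^ (k + 1) + y) ≤
      16 / 3 * T₀ ^ 2 + 4 * T₀ * (x + y) + (Nat.log 2 ⌊T₀⌋₊ + 1) * (x * y) := by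
  set k₀ := Nat.log 2 ⌊T₀⌋₊
  have h2k : (2 : ℝ) ^ k₀ ≤ T₀ := (two_pow_log_le hT).1
  have hexp : ∀ k : ℕ, ((2 : ℝ) ^ (k + 1) + x) * ((2 : ℝ) ^ (k + 1) + y) =
      4 * 4 ^ k + 2 * (x + y) * 2 ^ k + x * y := by
    intro k; rw [pow_succ, show (4 : ℝ) ^ k = (2 ^ k) ^ 2 by rw [← pow_mul, mul_comm, pow_mul]; norm_num]
    ring
  simp_rw [hexp]
  rw [sum_add_distrib, sum_add_distrib, ← mul_sum, ← mul_sum, sum_const, card_range, nsmul_eq_mul]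
  have hg4 : ∑ k ∈ range (k₀ + 1), (4 : ℝ) ^ k ≤ 4 / 3 * 4 ^ k₀ := by
    have := geom_sum_eq (x := (4 : ℝ)) (by norm_num) (k₀ + 1)
    rw [this, pow_succ]; nlinarith [pow_pos (by norm_num : (0 : ℝ) < 4) k₀]
  have hg2 : ∑ k ∈ range (k₀ + 1), (2 : ℝ) ^ k ≤ 2 * 2 ^ k₀ := by
    have := geom_sum_eq (x := (2 : ℝ)) (by norm_num) (k₀ + 1)
    rw [this, pow_succ]; nlinarith [pow_pos (by norm_num : (0 : ℝ) < 2) k₀]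
  have h4k : (4 : ℝ) ^ k₀ ≤ T₀ ^ 2 := by
    rw [show (4 : ℝ) ^ k₀ = (2 ^ k₀) ^ 2 by rw [← pow_mul, mul_comm, pow_mul]; norm_num]
    exact pow_le_pow_left₀ (by positivity) h2k 2
  have hxy : 0 ≤ x + y := by positivity
  push_cast
  nlinarith [mul_le_mul_of_nonneg_left hg2 (by positivity : (0 : ℝ) ≤ 2 * (x + y)),
    mul_le_mul_of_nonneg_left h2k hxy]

/-- The high blocks: `∑_{k₀ < k < K₁} (T₀/2^k)³ (2^{k+1}+x)(2^{k+1}+y) ≤ 8T₀² + (8/3)T₀(x+y) + (8/7)xy`. [folklore] -/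
theorem sum_high_blocks_le {T₀ x y : ℝ} (hT : 1 ≤ T₀) (hx : 0 ≤ x) (hy : 0 ≤ y) (K₁ : ℕ) :
    ∑ k ∈ Ico (Nat.log 2 ⌊T₀⌋₊ + 1) K₁, (T₀ / 2 ^ k) ^ 3 * (((2 : ℝ) ^ (k + 1) + x) * ((2 : ℝ) ^ (k + 1) + y)) ≤
      8 * T₀ ^ 2 + 8 / 3 * T₀ * (x + y) + 8 / 7 * (x * y) := by
  set k₀ := Nat.log 2 ⌊T₀⌋₊
  have hTlt : T₀ < (2 : ℝ) ^ (k₀ + 1) := (two_pow_log_le hT).2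
  have hT0 : 0 < T₀ := by linarith
  have hexp : ∀ k : ℕ, (T₀ / 2 ^ k) ^ 3 * (((2 : ℝ) ^ (k + 1) + x) * ((2 : ℝ) ^ (k + 1) + y)) =
      4 * T₀ ^ 3 * (1 / 2) ^ k + 2 * (x + y) * T₀ ^ 3 * (1 / 4) ^ k + x * y * T₀ ^ 3 * (1 / 8) ^ k := by
    intro k
    have h2 : (2 : ℝ) ^ k ≠ 0 := pow_ne_zero _ two_ne_zero
    rw [one_div_pow, one_div_pow, one_div_pow,
      show (4 : ℝ) ^ k = (2 ^ k) ^ 2 by rw [← pow_mul, mul_comm, pow_mul]; norm_num,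
      show (8 : ℝ) ^ k = (2 ^ k) ^ 3 by rw [← pow_mul, mul_comm, pow_mul]; norm_num, pow_succ]
    field_simp
    ring
  simp_rw [hexp]
  rw [sum_add_distrib, sum_add_distrib, ← mul_sum, ← mul_sum, ← mul_sum]
  have hI2 := geom_sum_Ico_le_of_lt_one (m := k₀ + 1) (n := K₁) (x := (1 / 2 : ℝ)) (by norm_num) (by norm_num)
  have hI4 := geom_sum_Ico_le_of_lt_one (m := k₀ + 1) (n := K₁) (x := (1 / 4 : ℝ)) (by norm_num) (by norm_num)
  have hI8 := geom_sum_Ico_le_of_lt_one (m := k₀ + 1) (n := K₁) (x := (1 / 8 : ℝ)) (by norm_num) (by norm_num)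
  -- `(1/2)^{k₀+1} < 1/T₀`
  have hhalf : (1 / 2 : ℝ) ^ (k₀ + 1) < 1 / T₀ := by
    rw [one_div_pow, one_div_lt_one_div (by positivity) hT0]; exact hTlt
  have hq : (1 / 4 : ℝ) ^ (k₀ + 1) < 1 / T₀ ^ 2 := by
    rw [show (1 / 4 : ℝ) ^ (k₀ + 1) = ((1 / 2) ^ (k₀ + 1)) ^ 2 by rw [← pow_mul, mul_comm, pow_mul]; norm_num,
      show 1 / T₀ ^ 2 = (1 / T₀) ^ 2 by rw [one_div_pow]]
    exact pow_lt_pow_left₀ hhalf (by positivity) two_ne_zero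
  have ho : (1 / 8 : ℝ) ^ (k₀ + 1) < 1 / T₀ ^ 3 := by
    rw [show (1 / 8 : ℝ) ^ (k₀ + 1) = ((1 / 2) ^ (k₀ + 1)) ^ 3 by rw [← pow_mul, mul_comm, pow_mul]; norm_num,
      show 1 / T₀ ^ 3 = (1 / T₀) ^ 3 by rw [one_div_pow]]
    exact pow_lt_pow_left₀ hhalf (by positivity) three_ne_zero
  have hS2 : ∑ i ∈ Ico (k₀ + 1) K₁, (1 / 2 : ℝ) ^ i ≤ 2 / T₀ := by
    refine hI2.trans ?_
    rw [show (1 : ℝ) - 1 / 2 = 1 / 2 by norm_num, div_div_eq_mul_div]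
    have := hhalf.le
    calc (1 / 2 : ℝ) ^ (k₀ + 1) * 2 / 1 = 2 * (1 / 2) ^ (k₀ + 1) := by ring
      _ ≤ 2 * (1 / T₀) := by gcongr
      _ = 2 / T₀ := by ring
  have hS4 : ∑ i ∈ Ico (k₀ + 1) K₁, (1 / 4 : ℝ) ^ i ≤ 4 / 3 / T₀ ^ 2 := by
    refine hI4.trans ?_
    rw [show (1 : ℝ) - 1 / 4 = 3 / 4 by norm_num]
    calc (1 / 4 : ℝ) ^ (k₀ + 1) / (3 / 4) = 4 / 3 * (1 / 4) ^ (k₀ + 1) := by ring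
      _ ≤ 4 / 3 * (1 / T₀ ^ 2) := by gcongr
      _ = 4 / 3 / T₀ ^ 2 := by ring
  have hS8 : ∑ i ∈ Ico (k₀ + 1) K₁, (1 / 8 : ℝ) ^ i ≤ 8 / 7 / T₀ ^ 3 := by
    refine hI8.trans ?_
    rw [show (1 : ℝ) - 1 / 8 = 7 / 8 by norm_num]
    calc (1 / 8 : ℝ) ^ (k₀ + 1) / (7 / 8) = 8 / 7 * (1 / 8) ^ (k₀ + 1) := by ring
      _ ≤ 8 / 7 * (1 / T₀ ^ 3) := by gcongr
      _ = 8 / 7 / T₀ ^ 3 := by ring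
  have hxy : 0 ≤ x + y := by positivity
  have e1 : 4 * T₀ ^ 3 * (2 / T₀) = 8 * T₀ ^ 2 := by field_simp; ring
  have e2 : 2 * (x + y) * T₀ ^ 3 * (4 / 3 / T₀ ^ 2) = 8 / 3 * T₀ * (x + y) := by field_simp; ring
  have e3 : x * y * T₀ ^ 3 * (8 / 7 / T₀ ^ 3) = 8 / 7 * (x * y) := by field_simp
  calc _ ≤ 4 * T₀ ^ 3 * (2 / T₀) + 2 * (x + y) * T₀ ^ 3 * (4 / 3 / T₀ ^ 2) + x * y * T₀ ^ 3 * (8 / 7 / T₀ ^ 3) := by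
        gcongr
    _ = _ := by rw [e1, e2, e3]

/-- **The dyadic sum of the transform majorant against the large-sieve block sizes**:
`∑_{k<K₁} min(1, (T₀/2^k)³) (2^{k+1}+x)(2^{k+1}+y) ≤ (14 + log₂⌊T₀⌋)(T₀+x)(T₀+y)` for `T₀ ≥ 1`,
`x, y ≥ 0` (the computation behind `D₁ + D₁₂ + D₂` in the proof of DI Theorem 8). [cite: DeshouillersIwaniec1982, §7.1 proof of Theorem 8 pp. 267–268] -/
theorem sum_blocks_le {T₀ x y : ℝ} (hT : 1 ≤ T₀) (hx : 0 ≤ x) (hy : 0 ≤ y) (K₁ : ℕ) :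
    ∑ k ∈ range K₁, min 1 ((T₀ / 2 ^ k) ^ 3) * (((2 : ℝ) ^ (k + 1) + x) * ((2 : ℝ) ^ (k + 1) + y)) ≤
      (14 + Nat.log 2 ⌊T₀⌋₊) * ((T₀ + x) * (T₀ + y)) := by
  set k₀ := Nat.log 2 ⌊T₀⌋₊ with hk₀
  have hT0 : 0 < T₀ := by linarith
  have hterm : ∀ k, 0 ≤ min 1 ((T₀ / 2 ^ k) ^ 3) * (((2 : ℝ) ^ (k + 1) + x) * ((2 : ℝ) ^ (k + 1) + y)) :=
    fun k => by positivity
  -- enlarge the range to `range (max K₁ (k₀+1))` and split at `k₀ + 1`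
  set K₂ := max K₁ (k₀ + 1)
  have hsub : range K₁ ⊆ range K₂ := range_subset_range.2 (le_max_left _ _)
  refine (sum_le_sum_of_subset_of_nonneg hsub fun k _ _ => hterm k).trans ?_
  rw [← sum_range_add_sum_Ico _ (le_max_right K₁ (k₀ + 1) : k₀ + 1 ≤ K₂)]
  have hlow : ∑ k ∈ range (k₀ + 1), min 1 ((T₀ / 2 ^ k) ^ 3) * (((2 : ℝ) ^ (k + 1) + x) * ((2 : ℝ) ^ (k + 1) + y)) ≤
      16 / 3 * T₀ ^ 2 + 4 * T₀ * (x + y) + (k₀ + 1) * (x * y) := by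
    refine le_trans (sum_le_sum fun k _ => ?_) (sum_low_blocks_le hT hx hy)
    calc _ ≤ 1 * (((2 : ℝ) ^ (k + 1) + x) * ((2 : ℝ) ^ (k + 1) + y)) :=
          mul_le_mul_of_nonneg_right (min_le_left _ _) (by positivity)
      _ = _ := one_mul _
  have hhigh : ∑ k ∈ Ico (k₀ + 1) K₂, min 1 ((T₀ / 2 ^ k) ^ 3) * (((2 : ℝ) ^ (k + 1) + x) * ((2 : ℝ) ^ (k + 1) + y)) ≤
      8 * T₀ ^ 2 + 8 / 3 * T₀ * (x + y) + 8 / 7 * (x * y) := by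
    refine le_trans (sum_le_sum fun k _ => ?_) (sum_high_blocks_le hT hx hy K₂)
    exact mul_le_mul_of_nonneg_right (min_le_right _ _) (by positivity)
  have hk0 : (0 : ℝ) ≤ k₀ := Nat.cast_nonneg _
  nlinarith [mul_nonneg hk0 (mul_nonneg hT0.le hx), mul_nonneg hk0 (mul_nonneg hT0.le hy),
    mul_nonneg hk0 (pow_nonneg hT0.le 2), mul_nonneg hx hy, mul_nonneg hT0.le hx, mul_nonneg hT0.le hy]

/-! ### The discrete block lemma (Maass forms, holomorphic forms) -/

/-- One block: if `w ≤ ω` and `h ≤ K` on `B ⊆ s`, then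
`∑_B w x y ≤ ω √(αβ) (K + √a)(K + √b)`. [folklore] -/
theorem block_le {ι : Type*} {s B : Finset ι} (h w x y : ι → ℝ) {ω K α β a b : ℝ}
    (hBs : B ⊆ s) (hK : 1 ≤ K) (hω : 0 ≤ ω) (hα : 0 ≤ α) (hβ : 0 ≤ β) (ha : 0 ≤ a) (hb : 0 ≤ b)
    (hx0 : ∀ j ∈ s, 0 ≤ x j) (hy0 : ∀ j ∈ s, 0 ≤ y j)
    (hwB : ∀ j ∈ B, w j ≤ ω) (hhB : ∀ j ∈ B, h j ≤ K)
    (hX : ∑ j ∈ s.filter (fun j => h j ≤ K), x j ^ 2 ≤ α * (K ^ 2 + a))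
    (hY : ∑ j ∈ s.filter (fun j => h j ≤ K), y j ^ 2 ≤ β * (K ^ 2 + b)) :
    ∑ j ∈ B, w j * x j * y j ≤ ω * Real.sqrt (α * β) * ((K + Real.sqrt a) * (K + Real.sqrt b)) := by
  have hBf : B ⊆ s.filter (fun j => h j ≤ K) := fun j hj => mem_filter.2 ⟨hBs hj, hhB j hj⟩
  have hx2 : ∑ j ∈ B, x j ^ 2 ≤ α * (K ^ 2 + a) :=
    (sum_le_sum_of_subset_of_nonneg hBf fun j _ _ => sq_nonneg (x j)).trans hX
  have hy2 : ∑ j ∈ B, y j ^ 2 ≤ β * (K ^ 2 + b) :=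
    (sum_le_sum_of_subset_of_nonneg hBf fun j _ _ => sq_nonneg (y j)).trans hY
  have h1 : ∑ j ∈ B, w j * x j * y j ≤ ω * ∑ j ∈ B, x j * y j := by
    rw [mul_sum]
    exact sum_le_sum fun j hj => by
      rw [mul_assoc]
      exact mul_le_mul_of_nonneg_right (hwB j hj) (mul_nonneg (hx0 j (hBs hj)) (hy0 j (hBs hj)))
  have hcs : ∑ j ∈ B, x j * y j ≤ Real.sqrt (∑ j ∈ B, x j ^ 2) * Real.sqrt (∑ j ∈ B, y j ^ 2) := by
    rw [← Real.sqrt_mul (sum_nonneg fun j _ => sq_nonneg _)]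
    refine Real.le_sqrt_of_sq_le ?_
    exact sum_mul_sq_le_sq_mul_sq B x y
  have hsa : Real.sqrt (α * (K ^ 2 + a)) ≤ Real.sqrt α * (K + Real.sqrt a) := by
    rw [Real.sqrt_mul hα]
    gcongr
    refine Real.sqrt_le_iff.2 ⟨by positivity, ?_⟩
    nlinarith [Real.sq_sqrt ha, Real.sqrt_nonneg a, sq_nonneg K]
  have hsb : Real.sqrt (β * (K ^ 2 + b)) ≤ Real.sqrt β * (K + Real.sqrt b) := by
    rw [Real.sqrt_mul hβ]
    gcongr
    refine Real.sqrt_le_iff.2 ⟨by positivity, ?_⟩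
    nlinarith [Real.sq_sqrt hb, Real.sqrt_nonneg b, sq_nonneg K]
  calc ∑ j ∈ B, w j * x j * y j ≤ ω * (Real.sqrt (∑ j ∈ B, x j ^ 2) * Real.sqrt (∑ j ∈ B, y j ^ 2)) :=
        h1.trans (mul_le_mul_of_nonneg_left hcs hω)
    _ ≤ ω * (Real.sqrt (α * (K ^ 2 + a)) * Real.sqrt (β * (K ^ 2 + b))) := by gcongr
    _ ≤ ω * ((Real.sqrt α * (K + Real.sqrt a)) * (Real.sqrt β * (K + Real.sqrt b))) := by gcongr
    _ = ω * Real.sqrt (α * β) * ((K + Real.sqrt a) * (K + Real.sqrt b)) := by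
        rw [Real.sqrt_mul hα]; ring

/-- The dyadic block index of a height `h ≥ 1`: `k = log₂ ⌊h⌋`, so `2^k ≤ h < 2^{k+2}`. [folklore] -/
theorem blk_bounds {h : ℝ} (hh : 1 ≤ h) :
    (2 : ℝ) ^ Nat.log 2 ⌊h⌋₊ ≤ h ∧ h ≤ (2 : ℝ) ^ (Nat.log 2 ⌊h⌋₊ + 2) := by
  obtain ⟨h1, h2⟩ := two_pow_log_le hh
  exact ⟨h1, by rw [pow_succ]; linarith [pow_pos (two_pos : (0 : ℝ) < 2) (Nat.log 2 ⌊h⌋₊ + 1)]⟩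

/-- **The discrete block lemma**: weights `w ≤ W` with `w ≤ W (T₀/h)³` at heights `h ≥ 1`, summed
against two families with the large-sieve bounds `∑_{h≤K} x² ≤ α(K²+a)`, `∑_{h≤K} y² ≤ β(K²+b)`
(`K ≥ 1`), give `∑ w x y ≤ (57 + 4 log₂⌊T₀⌋) W √(αβ) (T₀+√a)(T₀+√b)`. [cite: DeshouillersIwaniec1982, §7.1 proof of Theorem 8 pp. 267–268] -/
theorem blocks_discrete {ι : Type*} (s : Finset ι) (h w x y : ι → ℝ) {Wc T₀ α β a b : ℝ}
    (hT : 1 ≤ T₀) (hW : 0 ≤ Wc) (hα : 0 ≤ α) (hβ : 0 ≤ β) (ha : 0 ≤ a) (hb : 0 ≤ b)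
    (hx0 : ∀ j ∈ s, 0 ≤ x j) (hy0 : ∀ j ∈ s, 0 ≤ y j)
    (hw1 : ∀ j ∈ s, w j ≤ Wc) (hw2 : ∀ j ∈ s, 1 ≤ h j → w j ≤ Wc * (T₀ / h j) ^ 3)
    (hX : ∀ K : ℝ, 1 ≤ K → ∑ j ∈ s.filter (fun j => h j ≤ K), x j ^ 2 ≤ α * (K ^ 2 + a))
    (hY : ∀ K : ℝ, 1 ≤ K → ∑ j ∈ s.filter (fun j => h j ≤ K), y j ^ 2 ≤ β * (K ^ 2 + b)) :
    ∑ j ∈ s, w j * x j * y j ≤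
      (57 + 4 * Nat.log 2 ⌊T₀⌋₊) * Wc * Real.sqrt (α * β) * ((T₀ + Real.sqrt a) * (T₀ + Real.sqrt b)) := by
  classical
  set k₀ := Nat.log 2 ⌊T₀⌋₊
  set blk : ι → ℕ := fun j => Nat.log 2 ⌊h j⌋₊
  set s₀ := s.filter (fun j => h j < 1)
  set s₁ := s.filter (fun j => 1 ≤ h j)
  set K₁ := s.sup blk + 1
  have hsplit : ∑ j ∈ s, w j * x j * y j = ∑ j ∈ s₀, w j * x j * y j + ∑ j ∈ s₁, w j * x j * y j := by
    rw [← sum_filter_add_sum_filter_not s (fun j => h j < 1)]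
    congr 1
    exact sum_congr (by ext j; simp [s₁, not_lt]) fun _ _ => rfl
  -- the block `h < 1`
  have h0 : ∑ j ∈ s₀, w j * x j * y j ≤ Wc * Real.sqrt (α * β) * ((1 + Real.sqrt a) * (1 + Real.sqrt b)) :=
    block_le h w x y (filter_subset _ _) le_rfl hW hα hβ ha hb
      hx0 hy0 (fun j hj => hw1 j (filter_subset _ _ hj))
      (fun j hj => ((mem_filter.1 hj).2).le) (hX 1 le_rfl) (hY 1 le_rfl)
  -- the blocks `h ≥ 1`, fibered by `blk`
  have hmaps : ∀ j ∈ s₁, blk j ∈ range K₁ := fun j hj =>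
    mem_range.2 (Nat.lt_succ_of_le (le_sup (f := blk) (filter_subset _ _ hj)))
  have hfib : ∑ j ∈ s₁, w j * x j * y j = ∑ k ∈ range K₁, ∑ j ∈ s₁.filter (fun j => blk j = k), w j * x j * y j :=
    (sum_fiberwise_of_maps_to hmaps _).symm
  have hk : ∀ k ∈ range K₁, ∑ j ∈ s₁.filter (fun j => blk j = k), w j * x j * y j ≤
      Wc * min 1 ((T₀ / 2 ^ k) ^ 3) * Real.sqrt (α * β) *
        (((2 : ℝ) ^ (k + 2) + Real.sqrt a) * ((2 : ℝ) ^ (k + 2) + Real.sqrt b)) := by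
    intro k _
    have hK : (1 : ℝ) ≤ 2 ^ (k + 2) := one_le_pow₀ (by norm_num)
    refine block_le h w x y ((filter_subset _ _).trans (filter_subset _ _)) hK (by positivity) hα hβ ha hb
      hx0 hy0 ?_ ?_ (hX _ hK) (hY _ hK)
    · intro j hj
      obtain ⟨hj1, hjk⟩ := mem_filter.1 hj
      obtain ⟨hjs, hj1'⟩ := mem_filter.1 hj1
      obtain ⟨hlo, -⟩ := blk_bounds hj1'
      have hkk : Nat.log 2 ⌊h j⌋₊ = k := hjk
      rw [hkk] at hlo
      have hwj2 : w j ≤ Wc * (T₀ / 2 ^ k) ^ 3 :=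
        calc w j ≤ Wc * (T₀ / h j) ^ 3 := hw2 j hjs hj1'
          _ ≤ Wc * (T₀ / 2 ^ k) ^ 3 := by gcongr
      rcases le_total 1 ((T₀ / 2 ^ k) ^ 3) with hle | hle
      · rw [min_eq_left hle, mul_one]; exact hw1 j hjs
      · rw [min_eq_right hle]; exact hwj2
    · intro j hj
      obtain ⟨hj1, hjk⟩ := mem_filter.1 hj
      obtain ⟨-, hj1'⟩ := mem_filter.1 hj1
      obtain ⟨-, hhi⟩ := blk_bounds hj1'
      have hkk : Nat.log 2 ⌊h j⌋₊ = k := hjk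
      rwa [hkk] at hhi
  have hsum1 : ∑ j ∈ s₁, w j * x j * y j ≤
      4 * Wc * Real.sqrt (α * β) * ((14 + k₀) * ((T₀ + Real.sqrt a) * (T₀ + Real.sqrt b))) := by
    rw [hfib]
    refine (sum_le_sum hk).trans ?_
    have hterm : ∀ k : ℕ, Wc * min 1 ((T₀ / 2 ^ k) ^ 3) * Real.sqrt (α * β) *
        (((2 : ℝ) ^ (k + 2) + Real.sqrt a) * ((2 : ℝ) ^ (k + 2) + Real.sqrt b)) ≤
        4 * Wc * Real.sqrt (α * β) *
          (min 1 ((T₀ / 2 ^ k) ^ 3) * (((2 : ℝ) ^ (k + 1) + Real.sqrt a) * ((2 : ℝ) ^ (k + 1) + Real.sqrt b))) := by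
      intro k
      have hm : 0 ≤ min 1 ((T₀ / 2 ^ k) ^ 3) := le_min zero_le_one (by positivity)
      have h2 : ((2 : ℝ) ^ (k + 2) + Real.sqrt a) * ((2 : ℝ) ^ (k + 2) + Real.sqrt b) ≤
          4 * (((2 : ℝ) ^ (k + 1) + Real.sqrt a) * ((2 : ℝ) ^ (k + 1) + Real.sqrt b)) := by
        rw [pow_succ _ (k + 1)]
        nlinarith [Real.sqrt_nonneg a, Real.sqrt_nonneg b, pow_pos (two_pos : (0 : ℝ) < 2) (k + 1),
          mul_nonneg (Real.sqrt_nonneg a) (Real.sqrt_nonneg b)]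
      calc _ = Wc * Real.sqrt (α * β) * min 1 ((T₀ / 2 ^ k) ^ 3) *
            (((2 : ℝ) ^ (k + 2) + Real.sqrt a) * ((2 : ℝ) ^ (k + 2) + Real.sqrt b)) := by ring
        _ ≤ Wc * Real.sqrt (α * β) * min 1 ((T₀ / 2 ^ k) ^ 3) *
            (4 * (((2 : ℝ) ^ (k + 1) + Real.sqrt a) * ((2 : ℝ) ^ (k + 1) + Real.sqrt b))) := by
            gcongr
        _ = _ := by ring
    refine (sum_le_sum fun k _ => hterm k).trans ?_
    rw [← mul_sum]
    gcongr
    exact sum_blocks_le hT (Real.sqrt_nonneg a) (Real.sqrt_nonneg b) K₁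
  have h0' : ∑ j ∈ s₀, w j * x j * y j ≤ Wc * Real.sqrt (α * β) * ((T₀ + Real.sqrt a) * (T₀ + Real.sqrt b)) := by
    refine h0.trans ?_
    gcongr
  rw [hsplit]
  have hk0 : (0 : ℝ) ≤ k₀ := Nat.cast_nonneg _
  have hP : 0 ≤ Wc * Real.sqrt (α * β) * ((T₀ + Real.sqrt a) * (T₀ + Real.sqrt b)) := by positivity
  nlinarith [mul_nonneg hk0 hP]

/-! ### The continuous block lemma (Eisenstein series) -/

/-- `√(α(K²+a)) ≤ √α (K + √a)`. [folklore] -/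
theorem sqrt_mul_sq_add_le {α K a : ℝ} (hα : 0 ≤ α) (hK : 0 ≤ K) (ha : 0 ≤ a) :
    Real.sqrt (α * (K ^ 2 + a)) ≤ Real.sqrt α * (K + Real.sqrt a) := by
  rw [Real.sqrt_mul hα]
  gcongr
  refine Real.sqrt_le_iff.2 ⟨by positivity, ?_⟩
  nlinarith [Real.sq_sqrt ha, Real.sqrt_nonneg a, sq_nonneg K]

/-- One shell of the `t`-integral: if `ω ≤ W c` on a measurable `A ⊆ [-K, K]`, then
`∫_A ω X Y ≤ W c √(αβ) (K+√a)(K+√b)` given `∫_{-K}^{K} X² ≤ α(K²+a)`, `∫_{-K}^{K} Y² ≤ β(K²+b)`. [folklore] -/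
theorem shell_le (ω X Y : ℝ → ℝ) {A : Set ℝ} (hA : MeasurableSet A) {Wc c K α β a b : ℝ}
    (hW : 0 ≤ Wc) (hc : 0 ≤ c) (hK : 0 ≤ K) (hα : 0 ≤ α) (hβ : 0 ≤ β) (ha : 0 ≤ a) (hb : 0 ≤ b)
    (hX0 : ∀ t, 0 ≤ X t) (hY0 : ∀ t, 0 ≤ Y t) (hXm : Measurable X) (hYm : Measurable Y)
    (hAK : A ⊆ Set.Icc (-K) K) (hωA : ∀ t ∈ A, ω t ≤ Wc * c)
    (hX : ∫⁻ t in Set.Icc (-K) K, ENNReal.ofReal (X t ^ 2) ≤ ENNReal.ofReal (α * (K ^ 2 + a)))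
    (hY : ∫⁻ t in Set.Icc (-K) K, ENNReal.ofReal (Y t ^ 2) ≤ ENNReal.ofReal (β * (K ^ 2 + b))) :
    ∫⁻ t in A, ENNReal.ofReal (ω t * X t * Y t) ≤
      ENNReal.ofReal (Wc * c * Real.sqrt (α * β) * ((K + Real.sqrt a) * (K + Real.sqrt b))) := by
  -- pointwise: `ofReal (ω X Y) ≤ ofReal (W c) * (ofReal X * ofReal Y)` on `A`
  have hpt : ∀ t ∈ A, ENNReal.ofReal (ω t * X t * Y t) ≤
      ENNReal.ofReal (Wc * c) * ((fun t => ENNReal.ofReal (X t)) * fun t => ENNReal.ofReal (Y t)) t := by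
    intro t ht
    rw [Pi.mul_apply, ← ENNReal.ofReal_mul (hX0 t), ← ENNReal.ofReal_mul (mul_nonneg hW hc)]
    exact ENNReal.ofReal_le_ofReal (by
      have := hωA t ht
      have hxy : 0 ≤ X t * Y t := mul_nonneg (hX0 t) (hY0 t)
      nlinarith)
  have h1 : ∫⁻ t in A, ENNReal.ofReal (ω t * X t * Y t) ≤
      ENNReal.ofReal (Wc * c) * ∫⁻ t in A, ((fun t => ENNReal.ofReal (X t)) * fun t => ENNReal.ofReal (Y t)) t := by
    rw [← lintegral_const_mul' _ _ ENNReal.ofReal_ne_top]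
    exact setLIntegral_mono' hA hpt
  -- Hölder with `p = q = 2`
  have hXa : AEMeasurable (fun t => ENNReal.ofReal (X t)) (volume.restrict A) :=
    (ENNReal.measurable_ofReal.comp hXm).aemeasurable
  have hYa : AEMeasurable (fun t => ENNReal.ofReal (Y t)) (volume.restrict A) :=
    (ENNReal.measurable_ofReal.comp hYm).aemeasurable
  have hH := ENNReal.lintegral_mul_le_Lp_mul_Lq (volume.restrict A) Real.HolderConjugate.two_two hXa hYa
  have hX2 : ∫⁻ t in A, ENNReal.ofReal (X t) ^ (2 : ℝ) ≤ ENNReal.ofReal (α * (K ^ 2 + a)) := by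
    calc ∫⁻ t in A, ENNReal.ofReal (X t) ^ (2 : ℝ) = ∫⁻ t in A, ENNReal.ofReal (X t ^ 2) := by
          refine lintegral_congr fun t => ?_
          rw [ENNReal.rpow_two, ← ENNReal.ofReal_pow (hX0 t)]
      _ ≤ ∫⁻ t in Set.Icc (-K) K, ENNReal.ofReal (X t ^ 2) := lintegral_mono_set hAK
      _ ≤ _ := hX
  have hY2 : ∫⁻ t in A, ENNReal.ofReal (Y t) ^ (2 : ℝ) ≤ ENNReal.ofReal (β * (K ^ 2 + b)) := by
    calc ∫⁻ t in A, ENNReal.ofReal (Y t) ^ (2 : ℝ) = ∫⁻ t in A, ENNReal.ofReal (Y t ^ 2) := by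
          refine lintegral_congr fun t => ?_
          rw [ENNReal.rpow_two, ← ENNReal.ofReal_pow (hY0 t)]
      _ ≤ ∫⁻ t in Set.Icc (-K) K, ENNReal.ofReal (Y t ^ 2) := lintegral_mono_set hAK
      _ ≤ _ := hY
  have hhalf : (0 : ℝ) ≤ 1 / 2 := by norm_num
  have h2 : ∫⁻ t in A, ((fun t => ENNReal.ofReal (X t)) * fun t => ENNReal.ofReal (Y t)) t ≤
      ENNReal.ofReal (Real.sqrt (α * (K ^ 2 + a))) * ENNReal.ofReal (Real.sqrt (β * (K ^ 2 + b))) := by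
    refine hH.trans ?_
    gcongr
    · calc (∫⁻ t in A, ENNReal.ofReal (X t) ^ (2 : ℝ)) ^ (1 / (2 : ℝ))
            ≤ (ENNReal.ofReal (α * (K ^ 2 + a))) ^ (1 / (2 : ℝ)) := ENNReal.rpow_le_rpow hX2 hhalf
        _ = ENNReal.ofReal (Real.sqrt (α * (K ^ 2 + a))) := by
            rw [ENNReal.ofReal_rpow_of_nonneg (by positivity) hhalf, Real.sqrt_eq_rpow]
    · calc (∫⁻ t in A, ENNReal.ofReal (Y t) ^ (2 : ℝ)) ^ (1 / (2 : ℝ))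
            ≤ (ENNReal.ofReal (β * (K ^ 2 + b))) ^ (1 / (2 : ℝ)) := ENNReal.rpow_le_rpow hY2 hhalf
        _ = ENNReal.ofReal (Real.sqrt (β * (K ^ 2 + b))) := by
            rw [ENNReal.ofReal_rpow_of_nonneg (by positivity) hhalf, Real.sqrt_eq_rpow]
  calc _ ≤ ENNReal.ofReal (Wc * c) *
        (ENNReal.ofReal (Real.sqrt (α * (K ^ 2 + a))) * ENNReal.ofReal (Real.sqrt (β * (K ^ 2 + b)))) :=
        h1.trans (mul_le_mul_right h2 _)
    _ = ENNReal.ofReal (Wc * c * (Real.sqrt (α * (K ^ 2 + a)) * Real.sqrt (β * (K ^ 2 + b)))) := by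
        rw [← ENNReal.ofReal_mul (Real.sqrt_nonneg _), ← ENNReal.ofReal_mul (mul_nonneg hW hc)]
    _ ≤ _ := by
        refine ENNReal.ofReal_le_ofReal ?_
        have hsa := sqrt_mul_sq_add_le hα hK ha
        have hsb := sqrt_mul_sq_add_le hβ hK hb
        calc Wc * c * (Real.sqrt (α * (K ^ 2 + a)) * Real.sqrt (β * (K ^ 2 + b)))
            ≤ Wc * c * ((Real.sqrt α * (K + Real.sqrt a)) * (Real.sqrt β * (K + Real.sqrt b))) := by
              gcongr
          _ = _ := by rw [Real.sqrt_mul hα]; ring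

/-- The dyadic shells of the real line: `A₀ = {|t| < 1}`, `A_{k+1} = {2^k ≤ |t| < 2^{k+1}}`. [folklore] -/
def shell : ℕ → Set ℝ
  | 0 => {t | |t| < 1}
  | k + 1 => {t | (2 : ℝ) ^ k ≤ |t| ∧ |t| < (2 : ℝ) ^ (k + 1)}

/-- The shells are measurable. [folklore] -/
theorem measurableSet_shell : ∀ k, MeasurableSet (shell k)
  | 0 => measurableSet_lt continuous_abs.measurable measurable_const
  | _ + 1 => (measurableSet_le measurable_const continuous_abs.measurable).inter
      (measurableSet_lt continuous_abs.measurable measurable_const)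

/-- The shells are pairwise disjoint. [folklore] -/
theorem pairwise_disjoint_shell : Pairwise (Function.onFun Disjoint shell) := by
  intro i j hij
  rw [Function.onFun, Set.disjoint_left]
  intro t hi hj
  have key : ∀ i j : ℕ, i < j → t ∈ shell i → t ∈ shell j → False := by
    intro i j hij hi hj
    cases i with
    | zero =>
      cases j with
      | zero => exact absurd hij (lt_irrefl 0)
      | succ j =>
        simp only [shell, Set.mem_setOf_eq] at hi hj
        linarith [one_le_pow₀ (M₀ := ℝ) (a := 2) (n := j) (by norm_num), hj.1]
    | succ i =>
      cases j with
      | zero => exact absurd hij (Nat.not_lt_zero _)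
      | succ j =>
        simp only [shell, Set.mem_setOf_eq] at hi hj
        have h1 : |t| < (2 : ℝ) ^ (i + 1) := hi.2
        have h2 : (2 : ℝ) ^ j ≤ |t| := hj.1
        have h3 : i + 1 ≤ j := Nat.succ_le_of_lt (Nat.lt_of_succ_lt_succ hij)
        have h4 : (2 : ℝ) ^ (i + 1) ≤ 2 ^ j := pow_le_pow_right₀ (by norm_num) h3
        linarith
  rcases lt_or_gt_of_ne hij with h | h
  · exact key i j h hi hj
  · exact key j i h hj hi

/-- The shells cover the line. [folklore] -/
theorem iUnion_shell : (⋃ k, shell k) = Set.univ := by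
  refine Set.eq_univ_of_forall fun t => Set.mem_iUnion.2 ?_
  rcases lt_or_ge |t| 1 with h | h
  · exact ⟨0, h⟩
  · refine ⟨Nat.log 2 ⌊|t|⌋₊ + 1, ?_⟩
    exact two_pow_log_le h

/-- The bound for the `k`-th shell. [folklore] -/
def ublock (Wc T₀ α β a b : ℝ) : ℕ → ℝ
  | 0 => Wc * 1 * Real.sqrt (α * β) * ((1 + Real.sqrt a) * (1 + Real.sqrt b))
  | k + 1 => Wc * min 1 ((T₀ / 2 ^ k) ^ 3) * Real.sqrt (α * β) *
      (((2 : ℝ) ^ (k + 1) + Real.sqrt a) * ((2 : ℝ) ^ (k + 1) + Real.sqrt b))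

/-- Unfolding at `0`. [folklore] -/
@[simp] theorem ublock_zero (Wc T₀ α β a b : ℝ) :
    ublock Wc T₀ α β a b 0 = Wc * 1 * Real.sqrt (α * β) * ((1 + Real.sqrt a) * (1 + Real.sqrt b)) := rfl

/-- Unfolding at `k + 1`. [folklore] -/
@[simp] theorem ublock_succ (Wc T₀ α β a b : ℝ) (k : ℕ) :
    ublock Wc T₀ α β a b (k + 1) = Wc * min 1 ((T₀ / 2 ^ k) ^ 3) * Real.sqrt (α * β) *
      (((2 : ℝ) ^ (k + 1) + Real.sqrt a) * ((2 : ℝ) ^ (k + 1) + Real.sqrt b)) := rfl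

/-- `ublock k ≥ 0`. [folklore] -/
theorem ublock_nonneg {Wc T₀ α β a b : ℝ} (hW : 0 ≤ Wc) (hT : 0 ≤ T₀) : ∀ k, 0 ≤ ublock Wc T₀ α β a b k
  | 0 => by rw [ublock_zero]; positivity
  | k + 1 => by
      rw [ublock_succ]
      have : 0 ≤ (T₀ / 2 ^ k) ^ 3 := by positivity
      exact mul_nonneg (mul_nonneg (mul_nonneg hW (le_min zero_le_one this)) (Real.sqrt_nonneg _))
        (by positivity)

/-- **The continuous block lemma**: for measurable nonnegative `X, Y` with
`∫_{-K}^{K} X² ≤ α(K²+a)`, `∫_{-K}^{K} Y² ≤ β(K²+b)` (`K ≥ 1`) and a weight `ω ≤ W`,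
`ω(t) ≤ W (T₀/|t|)³` for `|t| ≥ 1`:
`∫_ℝ ω X Y ≤ (57 + 4 log₂⌊T₀⌋) W √(αβ) (T₀+√a)(T₀+√b)`. [cite: DeshouillersIwaniec1982, §7.1 proof of Theorem 8 pp. 267–268] -/
theorem blocks_continuous (ω X Y : ℝ → ℝ) {Wc T₀ α β a b : ℝ}
    (hT : 1 ≤ T₀) (hW : 0 ≤ Wc) (hα : 0 ≤ α) (hβ : 0 ≤ β) (ha : 0 ≤ a) (hb : 0 ≤ b)
    (hX0 : ∀ t, 0 ≤ X t) (hY0 : ∀ t, 0 ≤ Y t) (hXm : Measurable X) (hYm : Measurable Y)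
    (hω1 : ∀ t, ω t ≤ Wc) (hω2 : ∀ t, 1 ≤ |t| → ω t ≤ Wc * (T₀ / |t|) ^ 3)
    (hX : ∀ K : ℝ, 1 ≤ K → ∫⁻ t in Set.Icc (-K) K, ENNReal.ofReal (X t ^ 2) ≤ ENNReal.ofReal (α * (K ^ 2 + a)))
    (hY : ∀ K : ℝ, 1 ≤ K → ∫⁻ t in Set.Icc (-K) K, ENNReal.ofReal (Y t ^ 2) ≤ ENNReal.ofReal (β * (K ^ 2 + b))) :
    ∫⁻ t, ENNReal.ofReal (ω t * X t * Y t) ≤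
      ENNReal.ofReal ((57 + 4 * Nat.log 2 ⌊T₀⌋₊) * Wc * Real.sqrt (α * β) * ((T₀ + Real.sqrt a) * (T₀ + Real.sqrt b))) := by
  set k₀ := Nat.log 2 ⌊T₀⌋₊
  -- shell bounds
  set u : ℕ → ℝ := ublock Wc T₀ α β a b with hu
  have hshell : ∀ k, ∫⁻ t in shell k, ENNReal.ofReal (ω t * X t * Y t) ≤ ENNReal.ofReal (u k) := by
    intro k
    cases k with
    | zero =>
      rw [hu, ublock_zero]
      refine shell_le ω X Y (measurableSet_shell 0) hW zero_le_one zero_le_one hα hβ ha hb hX0 hY0 hXm hYm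
        ?_ (fun t _ => by simpa using hω1 t) (by simpa using hX 1 le_rfl) (by simpa using hY 1 le_rfl)
      intro t ht
      have : |t| < 1 := ht
      constructor <;> linarith [abs_lt.1 this |>.1, abs_lt.1 this |>.2]
    | succ k =>
      have hK : (1 : ℝ) ≤ 2 ^ (k + 1) := one_le_pow₀ (by norm_num)
      rw [hu, ublock_succ]
      refine shell_le ω X Y (measurableSet_shell (k + 1)) hW (le_min zero_le_one (by positivity)) (by positivity)
        hα hβ ha hb hX0 hY0 hXm hYm ?_ ?_ (hX _ hK) (hY _ hK)
      · intro t ht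
        obtain ⟨-, h2⟩ := ht
        constructor <;> linarith [abs_lt.1 h2 |>.1, abs_lt.1 h2 |>.2]
      · intro t ht
        obtain ⟨h1, -⟩ := ht
        have h1' : 1 ≤ |t| := le_trans (one_le_pow₀ (by norm_num)) h1
        rcases le_total 1 ((T₀ / 2 ^ k) ^ 3) with hle | hle
        · rw [min_eq_left hle, mul_one]; exact hω1 t
        · rw [min_eq_right hle]
          calc ω t ≤ Wc * (T₀ / |t|) ^ 3 := hω2 t h1'
            _ ≤ Wc * (T₀ / 2 ^ k) ^ 3 := by gcongr
  -- sum over the shells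
  have hdecomp : ∫⁻ t, ENNReal.ofReal (ω t * X t * Y t) = ∑' k, ∫⁻ t in shell k, ENNReal.ofReal (ω t * X t * Y t) := by
    rw [← lintegral_iUnion measurableSet_shell pairwise_disjoint_shell, iUnion_shell, Measure.restrict_univ]
  rw [hdecomp, ENNReal.tsum_eq_iSup_nat]
  refine iSup_le fun n => ?_
  calc ∑ k ∈ range n, ∫⁻ t in shell k, ENNReal.ofReal (ω t * X t * Y t) ≤ ∑ k ∈ range n, ENNReal.ofReal (u k) :=
        sum_le_sum fun k _ => hshell k
    _ = ENNReal.ofReal (∑ k ∈ range n, u k) := by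
        rw [ENNReal.ofReal_sum_of_nonneg]
        exact fun k _ => ublock_nonneg hW (by linarith) k
    _ ≤ _ := ENNReal.ofReal_le_ofReal ?_
  -- the real inequality on partial sums
  cases n with
  | zero => simp only [range_zero, sum_empty]; positivity
  | succ n =>
    rw [sum_range_succ']
    simp only [hu, ublock_zero, ublock_succ]
    have hmain := sum_blocks_le hT (Real.sqrt_nonneg a) (Real.sqrt_nonneg b) n
    have hk0 : (0 : ℝ) ≤ k₀ := Nat.cast_nonneg _
    have hP : 0 ≤ Wc * Real.sqrt (α * β) * ((T₀ + Real.sqrt a) * (T₀ + Real.sqrt b)) := by positivity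
    have h1 : (1 + Real.sqrt a) * (1 + Real.sqrt b) ≤ (T₀ + Real.sqrt a) * (T₀ + Real.sqrt b) := by
      gcongr
    have hrw : ∑ k ∈ range n, Wc * min 1 ((T₀ / 2 ^ k) ^ 3) * Real.sqrt (α * β) *
          (((2 : ℝ) ^ (k + 1) + Real.sqrt a) * ((2 : ℝ) ^ (k + 1) + Real.sqrt b)) =
        Wc * Real.sqrt (α * β) * ∑ k ∈ range n, min 1 ((T₀ / 2 ^ k) ^ 3) *
          (((2 : ℝ) ^ (k + 1) + Real.sqrt a) * ((2 : ℝ) ^ (k + 1) + Real.sqrt b)) := by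
      rw [mul_sum]; exact sum_congr rfl fun k _ => by ring
    rw [hrw]
    nlinarith [mul_le_mul_of_nonneg_left hmain (mul_nonneg hW (Real.sqrt_nonneg (α * β))),
      mul_le_mul_of_nonneg_left h1 (mul_nonneg hW (Real.sqrt_nonneg (α * β))), mul_nonneg hk0 hP]

/-! ### From bounds on finite families to bounds on sums of series -/

/-- If all finite partial sums of a family of nonnegative series, taken jointly over finitely many
levels, are `≤ B`, then each series converges and the sum of the series is `≤ B`. [folklore] -/
theorem sum_tsum_le_of_sum_sum_le {α : Type*} [DecidableEq α] {ι : α → Type*} (F : Finset α)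
    (g : ∀ r, ι r → ℝ) (hg : ∀ r j, 0 ≤ g r j) {B : ℝ}
    (h : ∀ s : ∀ r, Finset (ι r), ∑ r ∈ F, ∑ j ∈ s r, g r j ≤ B) :
    ∑ r ∈ F, ∑' j, g r j ≤ B := by
  induction F using Finset.induction_on generalizing B with
  | empty => simpa using h fun _ => ∅
  | insert a F ha ih =>
    rw [sum_insert ha]
    -- for every finite `u ⊆ ι a`: `∑_F ∑' ≤ B - ∑_u g a`
    have step : ∀ u : Finset (ι a), ∑ r ∈ F, ∑' j, g r j ≤ B - ∑ j ∈ u, g a j := by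
      intro u
      refine ih fun s => ?_
      have := h (Function.update s a u)
      rw [sum_insert ha, Function.update_self] at this
      have hF : ∑ r ∈ F, ∑ j ∈ Function.update s a u r, g r j = ∑ r ∈ F, ∑ j ∈ s r, g r j := by
        refine sum_congr rfl fun r hr => ?_
        rw [Function.update_of_ne (fun h : r = a => ha (h ▸ hr))]
      linarith
    have ha' : ∑' j, g a j ≤ B - ∑ r ∈ F, ∑' j, g r j :=
      Real.tsum_le_of_sum_le (hg a) fun u => by linarith [step u]
    linarith

/-- Summability of each series under the same hypothesis. [folklore] -/
theorem summable_of_sum_sum_le {α : Type*} [DecidableEq α] {ι : α → Type*} (F : Finset α)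
    (g : ∀ r, ι r → ℝ) (hg : ∀ r j, 0 ≤ g r j) {B : ℝ}
    (h : ∀ s : ∀ r, Finset (ι r), ∑ r ∈ F, ∑ j ∈ s r, g r j ≤ B) {r₀ : α} (hr₀ : r₀ ∈ F) :
    Summable (g r₀) := by
  refine summable_of_sum_le (hg r₀) (c := B) fun u => ?_
  have := h (Function.update (fun r => (∅ : Finset (ι r))) r₀ u)
  rw [← add_sum_erase F _ hr₀, Function.update_self] at this
  have h0 : ∑ r ∈ F.erase r₀, ∑ j ∈ Function.update (fun r => (∅ : Finset (ι r))) r₀ u r, g r j = 0 := by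
    refine sum_eq_zero fun r hr => ?_
    rw [Function.update_of_ne (ne_of_mem_erase hr)]
    exact sum_empty
  linarith

end DI

end Literature.NumberTheory.Sieve
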